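import Literature.AlgebraicGeometry.ComplexMultiplication.GenericCMFieldTypes
import HarnessLib

/-!
# Products of CM abelian varieties with CM by ONE pair-flip CM field: any two or three pairwise non-isogenous ones
# satisfy the Hodge conjecture on all their products; more than `[K:ℚ]/2` of them carry an exceptional Hodge class

COR-CM (cell `pub-hodgecm2`), seat p2 gen 21; count-neutral; theorems only, no definition, no named fact, no `sorry`.
Sequel of `CorCM/GenericCMFieldTypes` (pair-flip CM field `K`: every CM type nondegenerate; a family of types of `K` is
nondegenerate iff its type vectors `u_Φ = 𝟙_Φ − 𝟙_Φ̄ ∈ ℚ^{Hom(K,ℂ)}` are linearly independent; at most `[K:ℚ]/2`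
members for ANY CM field).

* §1 SIGN VECTORS: `±1`-valued functions which are pairwise distinct and pairwise non-opposite are linearly independent
  as soon as there are at most three of them (`linearIndependent_of_sign_of_card_le_three`; two: immediate; three: if
  `w = αu + βv` then `α ± β = ±1` at points where `u = ±v`, forcing `w ∈ {±u, ±v}`).
* §2 The type vector `u_Φ` is `±1`-valued, determines `Φ`, and `u_Ψ = −u_Φ` iff `Ψ = Φ̄`; realisations of `Φ` and
  of `Ψ ∈ {Φ, Φ̄}` are isogenous (`isIsogenous_of_eq`, `isIsogenous_of_eq_compl`), so PAIRWISE NON-ISOGENOUS realisations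
  have pairwise distinct, non-opposite type vectors.
* §3 For a pair-flip CM field `K` (`[K:ℚ] = 2n`) and pairwise non-isogenous abelian varieties `A_i` (`i ∈ I`) with CM
  by `K` (realising types `Φ_i`; all simple by `isSimple_of_pairFlip`):
  **`isNondegenerateFamily_of_card_le_three`** — `|I| ≤ 3` ⟹ the family is nondegenerate, hence
  **`hodgeConjectureFor_prod_of_card_le_three`** — the Hodge conjecture, with `B• = D•`, on EVERY product
  `⨁_{j<N} A_{π j}` (all `∏ A_i^{k_i}`), UNCONDITIONALLY; and **`exists_exceptional_prod_of_lt_card`** — `|I| > n` ⟹ an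
  exceptional Hodge class (a rational `(m,m)`-class outside `Dᵐ ⊗ ℂ`) on some product.
* §4 SEXTIC (`[K:ℚ] = 6`, pair flips ⟺ Galois closure of degree 24 or 48 ⟺ no imaginary quadratic subfield): there
  are four isogeny classes of (simple) CM abelian threefolds with CM by `K`; ANY THREE of them satisfy the Hodge
  conjecture on all their products (`hodgeConjectureFor_prod_sextic_three`), while the product of ALL FOUR carries an
  exceptional Hodge class (`exists_exceptional_prod_sextic_four`) — the threefold analogue of the `D₄` surface triple
  (`CorCM/DihedralReflexTripleCMHodge`); its algebraicity is open.

Provenance: Literature home (namespace `Literature.AlgebraicGeometry.ComplexMultiplication.GenericCMField`) of the Summits-side `CorCM/GenericCMFieldSameFieldFamiliesHodge` (cell `pub-hodgecm2`, COR-CM; all its imports are `Literature/`, Mathlib and the already re-homed `GenericCMFieldTypes`), which `Literature/` may not import; theorems only, no named fact, no definition. Nothing here bears on `HC_CM`. Lane `lit-hodgefound` (Layer A3: CM types, their Kubota ranks and Galois combinatorics), seat p20.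
-/

noncomputable section

open _root_.CategoryTheory _root_.CategoryTheory.Limits NumberField

namespace Literature.AlgebraicGeometry.ComplexMultiplication.GenericCMField

open Literature.NumberTheory.ComplexMultiplication
open Literature.AlgebraicGeometry.Motives (AbelianVariety CMType)
open Literature.AlgebraicGeometry.HodgeTheory
open Literature.AlgebraicGeometry.ComplexMultiplication (IsCMTypeRealisation)
open Literature.AlgebraicGeometry.VanGeemen1994 (hodgeClassSpan)
open Literature.AlgebraicGeometry.Pohlmann1968
open Literature.Barriers.HodgeConjecture (divisorClassesSpan)

/-! ## §1 Sign vectors: at most three pairwise distinct, non-opposite `±1`-vectors are linearly independent -/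

section Sign

variable {X : Type} [Nonempty X]

/-- Two `±1`-valued functions which are proportional are equal or opposite. [cite: Dodson1984, §3.2 and Thm. 3.3] -/
theorem eq_or_eq_neg_of_eq_smul {u v : X → ℚ} (hu : ∀ x, u x = 1 ∨ u x = -1) (hv : ∀ x, v x = 1 ∨ v x = -1)
    {c : ℚ} (h : v = c • u) : v = u ∨ v = -u := by
  obtain ⟨x₀⟩ := ‹Nonempty X›
  have hc : c = 1 ∨ c = -1 := by
    have h0 := congrFun h x₀
    simp only [Pi.smul_apply, smul_eq_mul] at h0
    rcases hu x₀ with h1 | h1 <;> rcases hv x₀ with h2 | h2 <;> [left; right; right; left] <;> nlinarith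
  rcases hc with rfl | rfl
  · left; simpa using h
  · right; rw [h]; funext x; simp

/-- **A linear relation `a u + b v = 0` between two distinct, non-opposite `±1`-vectors is trivial.** [cite: Dodson1984, §3.2 and Thm. 3.3] -/
theorem eq_zero_of_pair_rel {u v : X → ℚ} (hu : ∀ x, u x = 1 ∨ u x = -1) (hv : ∀ x, v x = 1 ∨ v x = -1)
    (hne : v ≠ u) (hne' : v ≠ -u) {a b : ℚ} (h : a • u + b • v = 0) : a = 0 ∧ b = 0 := by
  obtain ⟨x₀⟩ := ‹Nonempty X›
  by_cases hb : b = 0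
  · subst hb
    have h0 := congrFun h x₀
    simp only [Pi.add_apply, Pi.smul_apply, smul_eq_mul, zero_mul, add_zero, Pi.zero_apply, mul_eq_zero] at h0
    rcases h0 with h0 | h0
    · exact ⟨h0, rfl⟩
    · rcases hu x₀ with h1 | h1 <;> rw [h1] at h0 <;> norm_num at h0
  · exfalso
    have hv' : v = (-a / b) • u := by
      funext x
      have hx := congrFun h x
      simp only [Pi.add_apply, Pi.smul_apply, smul_eq_mul, Pi.zero_apply] at hx
      simp only [Pi.smul_apply, smul_eq_mul]
      field_simp
      linarith
    rcases eq_or_eq_neg_of_eq_smul hu hv hv' with h1 | h1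
    · exact hne h1
    · exact hne' h1

/-- **A linear relation `a u + b v + c w = 0` between three pairwise distinct, pairwise non-opposite `±1`-vectors is
trivial** (if `c ≠ 0` then `w = αu + βv`; at a point where `v = u` one reads `α + β = ±1`, at a point where
`v = −u` one reads `α − β = ±1`, so `(α, β) ∈ {(±1, 0), (0, ±1)}` and `w ∈ {±u, ±v}`). [cite: Dodson1984, §3.2 and Thm. 3.3] -/
theorem eq_zero_of_triple_rel {u v w : X → ℚ} (hu : ∀ x, u x = 1 ∨ u x = -1) (hv : ∀ x, v x = 1 ∨ v x = -1)
    (hw : ∀ x, w x = 1 ∨ w x = -1) (huv : v ≠ u) (huv' : v ≠ -u) (huw : w ≠ u) (huw' : w ≠ -u) (hvw : w ≠ v)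
    (hvw' : w ≠ -v) {a b c : ℚ} (h : a • u + b • v + c • w = 0) : a = 0 ∧ b = 0 ∧ c = 0 := by
  by_cases hc : c = 0
  · subst hc
    rw [zero_smul, add_zero] at h
    obtain ⟨ha, hb⟩ := eq_zero_of_pair_rel hu hv huv huv' h
    exact ⟨ha, hb, rfl⟩
  exfalso
  -- `w = α u + β v`
  set α : ℚ := -a / c with hα
  set β : ℚ := -b / c with hβ
  have hwx : ∀ x, w x = α * u x + β * v x := fun x => by
    have hx := congrFun h x
    simp only [Pi.add_apply, Pi.smul_apply, smul_eq_mul, Pi.zero_apply] at hx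
    rw [hα, hβ]
    field_simp
    linarith
  -- a point where `v = -u` and a point where `v = u`
  obtain ⟨x₁, hx₁⟩ : ∃ x, v x = -u x := by
    by_contra hno
    push Not at hno
    apply huv
    funext x
    rcases hu x with h1 | h1 <;> rcases hv x with h2 | h2
    · rw [h1, h2]
    · exact absurd (by rw [h1, h2]) (hno x)
    · exact absurd (by rw [h1, h2]; norm_num) (hno x)
    · rw [h1, h2]
  obtain ⟨x₂, hx₂⟩ : ∃ x, v x = u x := by
    by_contra hno
    push Not at hno
    apply huv'
    funext x
    rw [Pi.neg_apply]
    rcases hu x with h1 | h1 <;> rcases hv x with h2 | h2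
    · exact absurd (by rw [h1, h2]) (hno x)
    · rw [h1, h2]
    · rw [h1, h2]; norm_num
    · exact absurd (by rw [h1, h2]) (hno x)
  -- `α + β = ±1` and `α − β = ±1`
  have hsum : α + β = 1 ∨ α + β = -1 := by
    have h2 := hwx x₂
    rw [hx₂] at h2
    rcases hu x₂ with h1 | h1 <;> rcases hw x₂ with h3 | h3 <;> rw [h1, h3] at h2 <;>
      [left; right; right; left] <;> linarith
  have hdiff : α - β = 1 ∨ α - β = -1 := by
    have h2 := hwx x₁
    rw [hx₁] at h2
    rcases hu x₁ with h1 | h1 <;> rcases hw x₁ with h3 | h3 <;> rw [h1, h3] at h2 <;>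
      [left; right; right; left] <;> linarith
  -- four cases, each making `w` one of `±u, ±v`
  have hwfun : ∀ α' β' : ℚ, α = α' → β = β' → w = fun x => α' * u x + β' * v x := fun α' β' h1 h2 => by
    funext x; rw [hwx x, h1, h2]
  rcases hsum with h1 | h1 <;> rcases hdiff with h2 | h2
  · exact huw (by rw [hwfun 1 0 (by linarith) (by linarith)]; funext x; ring)
  · exact hvw (by rw [hwfun 0 1 (by linarith) (by linarith)]; funext x; ring)
  · exact hvw' (by rw [hwfun 0 (-1) (by linarith) (by linarith)]; funext x; simp)
  · exact huw' (by rw [hwfun (-1) 0 (by linarith) (by linarith)]; funext x; simp)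

/-- **At most three pairwise distinct, pairwise non-opposite `±1`-vectors are linearly independent.** [cite: Dodson1984, §3.2 and Thm. 3.3] -/
theorem linearIndependent_of_sign_of_card_le_three {I : Type} [Fintype I] (u : I → X → ℚ)
    (hu : ∀ i x, u i x = 1 ∨ u i x = -1) (hpair : ∀ i j, i ≠ j → u j ≠ u i ∧ u j ≠ -u i)
    (hcard : Fintype.card I ≤ 3) : LinearIndependent ℚ u := by
  classical
  -- reindex by `Fin m`, `m = |I| ≤ 3`
  obtain ⟨m, hm⟩ : ∃ m, Fintype.card I = m := ⟨_, rfl⟩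
  let e : I ≃ Fin m := Fintype.equivFinOfCardEq hm
  rw [← linearIndependent_equiv e.symm]
  set v : Fin m → X → ℚ := u ∘ e.symm with hv
  have hv1 : ∀ k x, v k x = 1 ∨ v k x = -1 := fun k x => hu _ x
  have hvp : ∀ k l : Fin m, k ≠ l → v l ≠ v k ∧ v l ≠ -v k := fun k l hkl =>
    hpair _ _ fun h => hkl (e.symm.injective h)
  rw [Fintype.linearIndependent_iff]
  intro g hg
  have hm3 : m ≤ 3 := hm ▸ hcard
  -- case analysis on `m ∈ {0, 1, 2, 3}`
  rcases Nat.lt_or_ge m 1 with hm0 | hm1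
  · intro k; exact (Nat.not_lt_zero _ (by omega : (k : ℕ) < 0)).elim
  rcases Nat.lt_or_ge m 2 with hm1' | hm2
  · obtain rfl : m = 1 := by omega
    rw [Fin.sum_univ_one] at hg
    intro k
    obtain rfl : k = 0 := Subsingleton.elim _ _
    obtain ⟨x₀⟩ := ‹Nonempty X›
    have h0 := congrFun hg x₀
    simp only [Pi.smul_apply, smul_eq_mul, Pi.zero_apply, mul_eq_zero] at h0
    rcases h0 with h0 | h0
    · exact h0
    · rcases hv1 0 x₀ with h1 | h1 <;> rw [h1] at h0 <;> norm_num at h0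
  rcases Nat.lt_or_ge m 3 with hm2' | hm3'
  · obtain rfl : m = 2 := by omega
    rw [Fin.sum_univ_two] at hg
    obtain ⟨h0, h1⟩ := eq_zero_of_pair_rel (hv1 0) (hv1 1) (hvp 0 1 (by decide)).1 (hvp 0 1 (by decide)).2 hg
    intro k
    fin_cases k
    · exact h0
    · exact h1
  · obtain rfl : m = 3 := by omega
    rw [Fin.sum_univ_three] at hg
    obtain ⟨h0, h1, h2⟩ := eq_zero_of_triple_rel (hv1 0) (hv1 1) (hv1 2) (hvp 0 1 (by decide)).1
      (hvp 0 1 (by decide)).2 (hvp 0 2 (by decide)).1 (hvp 0 2 (by decide)).2 (hvp 1 2 (by decide)).1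
      (hvp 1 2 (by decide)).2 hg
    intro k
    fin_cases k
    · exact h0
    · exact h1
    · exact h2

end Sign

/-! ## §2 Type vectors of CM types: `±1`-valued, injective, opposite iff complementary -/

section TypeVectors

variable {K : Type} [Field K]

/-- The type vector `u_Φ = 𝟙_Φ − 𝟙_Φ̄` takes the values `±1`. [cite: Dodson1984, §3.2 and Thm. 3.3] -/
theorem antiVec_one_apply_eq_or (Φ : CMType K) (s : K →+* ℂ) :
    antiVec Φ.1 (1 : ℂ ≃+* ℂ) s = 1 ∨ antiVec Φ.1 (1 : ℂ ≃+* ℂ) s = -1 := by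
  simp only [antiVec]
  by_cases hs : (1 : ℂ ≃+* ℂ) • s ∈ Φ.1
  · rw [translateInd_of_mem hs]; norm_num
  · rw [translateInd_of_not_mem hs]; norm_num

/-- The value of the type vector at `s` is `1` iff `s ∈ Φ`. [cite: Dodson1984, §3.2 and Thm. 3.3] -/
theorem antiVec_one_apply_eq_one_iff (Φ : CMType K) (s : K →+* ℂ) :
    antiVec Φ.1 (1 : ℂ ≃+* ℂ) s = 1 ↔ s ∈ Φ.1 := by
  simp only [antiVec]
  by_cases hs : (1 : ℂ ≃+* ℂ) • s ∈ Φ.1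
  · rw [translateInd_of_mem hs]
    rw [one_smul] at hs
    exact ⟨fun _ => hs, fun _ => by norm_num⟩
  · rw [translateInd_of_not_mem hs]
    rw [one_smul] at hs
    exact ⟨fun h => by norm_num at h, fun h => (hs h).elim⟩

/-- **The type vector determines the type**: `u_Ψ = u_Φ ⟹ Ψ = Φ`. [cite: Dodson1984, §3.2 and Thm. 3.3] -/
theorem eq_of_antiVec_one_eq {Φ Ψ : CMType K} (h : antiVec Ψ.1 (1 : ℂ ≃+* ℂ) = antiVec Φ.1 (1 : ℂ ≃+* ℂ)) :
    Ψ = Φ := by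
  refine Subtype.ext (Set.ext fun s => ?_)
  rw [← antiVec_one_apply_eq_one_iff, ← antiVec_one_apply_eq_one_iff, h]

/-- **Opposite type vectors ⟹ complementary (conjugate) types**: `u_Ψ = −u_Φ ⟹ Ψ = Φ̄ = Hom(K,ℂ) ∖ Φ`. [cite: Dodson1984, §3.2 and Thm. 3.3] -/
theorem eq_compl_of_antiVec_one_eq_neg {Φ Ψ : CMType K}
    (h : antiVec Ψ.1 (1 : ℂ ≃+* ℂ) = -antiVec Φ.1 (1 : ℂ ≃+* ℂ)) : Ψ.1 = Φ.1ᶜ := by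
  ext s
  rw [Set.mem_compl_iff, ← antiVec_one_apply_eq_one_iff, ← antiVec_one_apply_eq_one_iff, h, Pi.neg_apply]
  rcases antiVec_one_apply_eq_or Φ s with h1 | h1 <;> rw [h1] <;> norm_num

variable [NumberField K] [IsCMField K] {A A' : AbelianVariety ℂ} {ι : 𝓞 K →+* End A}
  {θ : K →+* Module.End ℂ (complexBetti A.X 1)} {ι' : 𝓞 K →+* End A'} {θ' : K →+* Module.End ℂ (complexBetti A'.X 1)}

/-- **Realisations of the same CM type are isogenous** (Shimura §6.1 Corollary). [cite: Dodson1984, §3.2 and Thm. 3.3] -/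
theorem isIsogenous_of_eq {Φ Ψ : CMType K} (hA : IsCMTypeRealisation Φ A ι θ) (hA' : IsCMTypeRealisation Ψ A' ι' θ')
    (h : Ψ = Φ) : AbelianVariety.IsIsogenous A A' :=
  isIsogenous_of_forall_mem_iff_comp (RingEquiv.refl K) (fun u => by subst h; rfl) hA hA'

/-- **Realisations of conjugate CM types are isogenous** (`Φ̄ = Φ ∘ c_K` for the complex conjugation `c_K` of the CM
field `K`; Shimura §6.1 Corollary). [cite: Dodson1984, §3.2 and Thm. 3.3] -/
theorem isIsogenous_of_eq_compl {Φ Ψ : CMType K} (hA : IsCMTypeRealisation Φ A ι θ)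
    (hA' : IsCMTypeRealisation Ψ A' ι' θ') (h : Ψ.1 = Φ.1ᶜ) : AbelianVariety.IsIsogenous A A' := by
  refine isIsogenous_of_forall_mem_iff_comp (IsCMField.complexConj K).toRingEquiv (fun u => ?_) hA hA'
  have hu : u.comp (IsCMField.complexConj K).toRingEquiv.toRingHom = ComplexEmbedding.conjugate u :=
    RingHom.ext fun x => by
      change u (IsCMField.complexConj K x) = _
      rw [IsCMField.complexEmbedding_complexConj]
      rfl
  rw [hu, h, Set.mem_compl_iff, Φ.2 u, not_not]

/-- **Non-isogenous realisations have distinct, non-opposite type vectors.** [cite: Dodson1984, §3.2 and Thm. 3.3] -/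
theorem antiVec_ne_of_not_isIsogenous {Φ Ψ : CMType K} (hA : IsCMTypeRealisation Φ A ι θ)
    (hA' : IsCMTypeRealisation Ψ A' ι' θ') (hn : ¬AbelianVariety.IsIsogenous A A') :
    antiVec Ψ.1 (1 : ℂ ≃+* ℂ) ≠ antiVec Φ.1 (1 : ℂ ≃+* ℂ) ∧
      antiVec Ψ.1 (1 : ℂ ≃+* ℂ) ≠ -antiVec Φ.1 (1 : ℂ ≃+* ℂ) :=
  ⟨fun h => hn (isIsogenous_of_eq hA hA' (eq_of_antiVec_one_eq h)),
    fun h => hn (isIsogenous_of_eq_compl hA hA' (eq_compl_of_antiVec_one_eq_neg h))⟩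

end TypeVectors

/-! ## §3 Pair-flip fields: up to three non-isogenous varieties — the Hodge conjecture; more than `n` — exceptional classes -/

section Geometry

variable {K : Type} [Field K] [NumberField K] [IsCMField K] {I : Type} [Fintype I] [Nonempty I]
  {Φ : I → CMType K} {A : I → AbelianVariety ℂ} {ι : ∀ i, 𝓞 K →+* End (A i)}
  {θ : ∀ i, K →+* Module.End ℂ (complexBetti (A i).X 1)}

/-- **Pair-flip field, at most three pairwise non-isogenous CM abelian varieties with CM by `K`: the family of their CM
types is nondegenerate** (`Hg(∏ A_i) = ∏ Hg(A_i)` of full rank). [cite: Dodson1984, §3.2 and Thm. 3.3] -/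
theorem isNondegenerateFamily_of_card_le_three
    (hflip : ∀ s : K →+* ℂ, ∃ σ : ℂ ≃+* ℂ, σ • s = (starRingAut : ℂ ≃+* ℂ) • s ∧
      ∀ t : K →+* ℂ, t ≠ s → t ≠ (starRingAut : ℂ ≃+* ℂ) • s → σ • t = t)
    (hA : ∀ i, IsCMTypeRealisation (Φ i) (A i) (ι i) (θ i))
    (hniso : ∀ i j, i ≠ j → ¬AbelianVariety.IsIsogenous (A i) (A j)) (hcard : Fintype.card I ≤ 3) :
    CMAlgebra.IsNondegenerateFamily (K := fun _ : I => K) Φ := by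
  classical
  rw [isNondegenerateFamily_iff_linearIndependent_of_pairFlip hflip]
  exact linearIndependent_of_sign_of_card_le_three (fun i => antiVec (Φ i).1 (1 : ℂ ≃+* ℂ))
    (fun i s => antiVec_one_apply_eq_or (Φ i) s)
    (fun i j hij => antiVec_ne_of_not_isIsogenous (hA i) (hA j) (hniso i j hij)) hcard

/-- **The Hodge conjecture for every product `⨁_{j<N} A_{π j}` (every `∏_i A_i^{k_i}`) of at most three pairwise
non-isogenous abelian varieties with complex multiplication by one pair-flip CM field `K`**, UNCONDITIONALLY. [cite: Dodson1984, §3.2 and Thm. 3.3] -/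
theorem hodgeConjectureFor_prod_of_card_le_three
    (hflip : ∀ s : K →+* ℂ, ∃ σ : ℂ ≃+* ℂ, σ • s = (starRingAut : ℂ ≃+* ℂ) • s ∧
      ∀ t : K →+* ℂ, t ≠ s → t ≠ (starRingAut : ℂ ≃+* ℂ) • s → σ • t = t)
    (hA : ∀ i, IsCMTypeRealisation (Φ i) (A i) (ι i) (θ i))
    (hniso : ∀ i j, i ≠ j → ¬AbelianVariety.IsIsogenous (A i) (A j)) (hcard : Fintype.card I ≤ 3)
    {N : ℕ} (π : Fin N → I) :
    HodgeConjectureFor (⨁ fun j : Fin N => A (π j)).dim (⨁ fun j : Fin N => A (π j)).X :=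
  (isNondegenerateFamily_of_card_le_three hflip hA hniso hcard).hodgeConjectureFor_prod
    (K := fun _ : I => K) hA π

/-- … and on these products every Hodge class is a polynomial in divisor classes: `Bᵐ ⊗ ℂ = Dᵐ ⊗ ℂ`. [cite: Dodson1984, §3.2 and Thm. 3.3] -/
theorem hodgeClassSpan_prod_eq_of_card_le_three
    (hflip : ∀ s : K →+* ℂ, ∃ σ : ℂ ≃+* ℂ, σ • s = (starRingAut : ℂ ≃+* ℂ) • s ∧
      ∀ t : K →+* ℂ, t ≠ s → t ≠ (starRingAut : ℂ ≃+* ℂ) • s → σ • t = t)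
    (hA : ∀ i, IsCMTypeRealisation (Φ i) (A i) (ι i) (θ i))
    (hniso : ∀ i j, i ≠ j → ¬AbelianVariety.IsIsogenous (A i) (A j)) (hcard : Fintype.card I ≤ 3)
    {N : ℕ} (π : Fin N → I) (m : ℕ) :
    hodgeClassSpan (⨁ fun j : Fin N => A (π j)).dim (⨁ fun j : Fin N => A (π j)).X m =
      divisorClassesSpan (⨁ fun j : Fin N => A (π j)).X (⨁ fun j : Fin N => A (π j)).dim m :=
  (isNondegenerateFamily_of_card_le_three hflip hA hniso hcard).hodgeClassSpan_prod_eq_divisorClassesSpan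
    (K := fun _ : I => K) hA π m

/-- **More than `[K:ℚ]/2` pairwise non-isogenous CM abelian varieties with CM by one pair-flip CM field `K` carry an
exceptional Hodge class on some product `⨁_{j<N} A_{π j}`**: a rational `(m,m)`-class outside the span of intersections
of divisors (the family is separating — all `A_i` are simple — but cannot be nondegenerate, having more members than
the odd weights have dimensions). [cite: Dodson1984, §3.2 and Thm. 3.3] -/
theorem exists_exceptional_prod_of_lt_card
    (hflip : ∀ s : K →+* ℂ, ∃ σ : ℂ ≃+* ℂ, σ • s = (starRingAut : ℂ ≃+* ℂ) • s ∧
      ∀ t : K →+* ℂ, t ≠ s → t ≠ (starRingAut : ℂ ≃+* ℂ) • s → σ • t = t)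
    (hA : ∀ i, IsCMTypeRealisation (Φ i) (A i) (ι i) (θ i))
    (hniso : ∀ i j, i ≠ j → ¬AbelianVariety.IsIsogenous (A i) (A j))
    (hcard : Module.finrank ℚ K / 2 < Fintype.card I) :
    ∃ (N : ℕ) (π : Fin N → I) (m : ℕ) (c : complexBetti (⨁ fun j : Fin N => A (π j)).X (2 * m)),
      IsRationalClass c ∧
      IsOfHodgeType (⨁ fun j : Fin N => A (π j)).dim (⨁ fun j : Fin N => A (π j)).X (2 * m) m m c ∧
      c ∉ divisorClassesSpan (⨁ fun j : Fin N => A (π j)).X (⨁ fun j : Fin N => A (π j)).dim m :=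
  CMAlgebra.exists_exceptional_prod_of_not_isNondegenerateFamily (K := fun _ : I => K)
    (CMAlgebra.isSeparatingFamily_of_isSimple_of_pairwise_not_isIsogenous hA (fun i => isSimple_of_pairFlip hflip (hA i))
      hniso)
    (fun hΦ => absurd (card_le_finrank_div_two_of_isNondegenerateFamily Φ hΦ) (not_le.2 hcard)) hA

end Geometry

/-! ## §4 Sextic pair-flip fields: any three of the four classes — Hodge conjecture; all four — an exceptional class -/

section Sextic

variable {K : Type} [Field K] [NumberField K] [IsCMField K] {I : Type} [Fintype I] [Nonempty I]
  {Φ : I → CMType K} {A : I → AbelianVariety ℂ} {ι : ∀ i, 𝓞 K →+* End (A i)}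
  {θ : ∀ i, K →+* Module.End ℂ (complexBetti (A i).X 1)}

/-- **Three pairwise non-isogenous CM abelian varieties with CM by one pair-flip CM field (e.g. three of the four
isogeny classes of simple CM abelian threefolds with CM by a sextic CM field without imaginary quadratic subfield):
the Hodge conjecture holds on every product `X₁^a × X₂^b × X₃^c`**, UNCONDITIONALLY. [cite: Dodson1984, §3.2 and Thm. 3.3] -/
theorem hodgeConjectureFor_prod_three
    (hflip : ∀ s : K →+* ℂ, ∃ σ : ℂ ≃+* ℂ, σ • s = (starRingAut : ℂ ≃+* ℂ) • s ∧
      ∀ t : K →+* ℂ, t ≠ s → t ≠ (starRingAut : ℂ ≃+* ℂ) • s → σ • t = t)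
    (hA : ∀ i, IsCMTypeRealisation (Φ i) (A i) (ι i) (θ i))
    (hniso : ∀ i j, i ≠ j → ¬AbelianVariety.IsIsogenous (A i) (A j)) (hcard : Fintype.card I = 3)
    {N : ℕ} (π : Fin N → I) :
    HodgeConjectureFor (⨁ fun j : Fin N => A (π j)).dim (⨁ fun j : Fin N => A (π j)).X :=
  hodgeConjectureFor_prod_of_card_le_three hflip hA hniso hcard.le π

/-- **Sextic pair-flip CM field: FOUR pairwise non-isogenous CM abelian threefolds with CM by `K` carry an exceptional
Hodge class on some product** (e.g. a Künneth `(1,1,1,1)`-class on the 12-fold `X₁ × X₂ × X₃ × X₄`): the four type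
vectors live in the `3`-dimensional odd weights.  Its algebraicity is an open instance of the Hodge conjecture. [cite: Dodson1984, §3.2 and Thm. 3.3] -/
theorem exists_exceptional_prod_sextic_four (h6 : Module.finrank ℚ K = 6)
    (hflip : ∀ s : K →+* ℂ, ∃ σ : ℂ ≃+* ℂ, σ • s = (starRingAut : ℂ ≃+* ℂ) • s ∧
      ∀ t : K →+* ℂ, t ≠ s → t ≠ (starRingAut : ℂ ≃+* ℂ) • s → σ • t = t)
    (hA : ∀ i, IsCMTypeRealisation (Φ i) (A i) (ι i) (θ i))
    (hniso : ∀ i j, i ≠ j → ¬AbelianVariety.IsIsogenous (A i) (A j)) (hcard : Fintype.card I = 4) :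
    ∃ (N : ℕ) (π : Fin N → I) (m : ℕ) (c : complexBetti (⨁ fun j : Fin N => A (π j)).X (2 * m)),
      IsRationalClass c ∧
      IsOfHodgeType (⨁ fun j : Fin N => A (π j)).dim (⨁ fun j : Fin N => A (π j)).X (2 * m) m m c ∧
      c ∉ divisorClassesSpan (⨁ fun j : Fin N => A (π j)).X (⨁ fun j : Fin N => A (π j)).dim m :=
  exists_exceptional_prod_of_lt_card hflip hA hniso (by rw [h6, hcard]; norm_num)

end Sextic

end Literature.AlgebraicGeometry.ComplexMultiplication.GenericCMField
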